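import Literature.NumberTheory.EllipticCurves.DeShalit1987.KatzMeasureMonomialLinesPAdic
import Mathlib.Tactic
import HarnessLib

set_option autoImplicit false

/-!
# The restriction to a formal curve through the origin is a RING HOMOMORPHISM
# `R⟦T₁⟧⟦T₂⟧ → R⟦T⟧`: `(G·H)(a₁, a₂) = G(a₁, a₂)·H(a₁, a₂)` (all PROVED; no definition, no named fact)

Topic `NumberTheory/EllipticCurves` (receptacle `R⟦T₁⟧⟦T₂⟧`; `IntSeries.curveSubst a₁ a₂ G = G(a₁(T), a₂(T))`
of `DeShalit1987/KatzMeasureMonomialLines.lean`, defined coefficientwise by the finite sums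
`[Tⁿ] = Σ_{i,j ≤ n} [T₁^iT₂^j]G·[Tⁿ](a₁^ia₂^j)`; the monomial lines `IntSeries.monomialLine c₁ c₂` are the case
`a_i = (1+T)^{c_i} − 1`).  de Shalit 1987, II.4.17 (51)–(54): the restriction of the two-variable
`G(χ; T₁, T₂)` (`1 + T_i ↔ γ_i`) to a `ℤ_p`-line is induced by the group homomorphism `ℤ_p → ℤ_p²` — a
ring homomorphism of completed group rings, which the coefficientwise definition does not display.  Here
it is PROVED, by pure algebra over any commutative ring `R` for curves through the origin
(`a₁(0) = a₂(0) = 0`):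

* `curveSubst_add`, `curveSubst_neg`, `curveSubst_sub`, `curveSubst_smul` (linearity, any `a₁, a₂`);
* `curveSubst_C_C` (`curveSubst a₁ a₂ (C (C c)) = C c`), `curveSubst_one`;
* **`curveSubst_mul`** — `curveSubst a₁ a₂ (G * H) = curveSubst a₁ a₂ G * curveSubst a₁ a₂ H` (the
  coefficient of `Tⁿ` on both sides is the finite sum
  `Σ_{i+k ≤ n, j+l ≤ n} G_{ij}H_{kl}[Tⁿ](a₁^{i+k}a₂^{j+l})`, regrouped along antidiagonals);
  `curveSubst_pow`;
* the monomial-line forms `monomialLine_add/_sub/_mul/_pow/_C_C/_one/_smul`.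

USE (cell `bsd-print-cf2`, route C, «(R) period rigidity» lane of item 23722): the two-variable rigidity
identity `G' = C₀·(1+T₁)^x(1+T₂)^w·G` is assembled from its restrictions to infinitely many `ℤ_p`-lines
(`IntSeries.eq_of_monomialLine_eq`); computing the restriction of the PRODUCT `(1+T₁)^x(1+T₂)^w·G` needs
this multiplicativity.

## References

* [deShalit1987] E. de Shalit, *Iwasawa theory of elliptic curves with complex multiplication* (1987),
  II.4.17 (51)–(54) (p. 77–78).
* [Koblitz1984] N. Koblitz, *p-adic Numbers, p-adic Analysis, and Zeta-Functions*, GTM 58, Ch. IV §1.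
-/

noncomputable section

open Finset
open Literature.NumberTheory.EllipticCurves.GreenbergVatsal2000

namespace Literature.NumberTheory.EllipticCurves

namespace IntSeries

section Formal

variable {R : Type*} [CommRing R] (a₁ a₂ : PowerSeries R)

/-! ### §1. Linearity (any `a₁, a₂`) -/

/-- Additivity of the restriction. [cite: deShalit1987, II.4.17 (51)–(54) (p. 77–78)] -/
theorem curveSubst_add (G H : PowerSeries (PowerSeries R)) :
    curveSubst a₁ a₂ (G + H) = curveSubst a₁ a₂ G + curveSubst a₁ a₂ H := by
  ext n
  simp only [coeff_curveSubst, map_add, add_mul, sum_add_distrib]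

/-- The restriction of `−G`. [cite: deShalit1987, II.4.17 (51)–(54) (p. 77–78)] -/
theorem curveSubst_neg (G : PowerSeries (PowerSeries R)) :
    curveSubst a₁ a₂ (-G) = -curveSubst a₁ a₂ G := by
  ext n
  simp only [coeff_curveSubst, map_neg, neg_mul, sum_neg_distrib]

/-- The restriction of a difference. [cite: deShalit1987, II.4.17 (51)–(54) (p. 77–78)] -/
theorem curveSubst_sub (G H : PowerSeries (PowerSeries R)) :
    curveSubst a₁ a₂ (G - H) = curveSubst a₁ a₂ G - curveSubst a₁ a₂ H := by
  rw [sub_eq_add_neg, curveSubst_add, curveSubst_neg, ← sub_eq_add_neg]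

/-- `R`-linearity: the restriction of `c • G` (`c ∈ R` acting on both variables' coefficients).
[cite: deShalit1987, II.4.17 (51)–(54) (p. 77–78)] -/
theorem curveSubst_C_C_mul (c : R) (G : PowerSeries (PowerSeries R)) :
    curveSubst a₁ a₂ (PowerSeries.C (PowerSeries.C c) * G) = PowerSeries.C c * curveSubst a₁ a₂ G := by
  ext n
  simp only [coeff_curveSubst, PowerSeries.coeff_C_mul, mul_sum, mul_assoc]

/-- **Constants restrict to constants**: `curveSubst a₁ a₂ (C (C c)) = C c`.
[cite: deShalit1987, II.4.17 (51)–(54) (p. 77–78)] -/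
theorem curveSubst_C_C (c : R) :
    curveSubst a₁ a₂ (PowerSeries.C (PowerSeries.C c)) = PowerSeries.C c := by
  ext n
  rw [coeff_curveSubst, sum_eq_single 0, sum_eq_single 0]
  · simp [PowerSeries.coeff_C]
  · intro j _ hj
    rw [PowerSeries.coeff_C, if_pos rfl, PowerSeries.coeff_C, if_neg hj, zero_mul]
  · simp
  · intro i _ hi
    exact sum_eq_zero fun j _ ↦ by rw [PowerSeries.coeff_C, if_neg hi, map_zero, zero_mul]
  · simp

/-- `curveSubst a₁ a₂ 1 = 1`. [cite: deShalit1987, II.4.17 (51)–(54) (p. 77–78)] -/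
theorem curveSubst_one : curveSubst a₁ a₂ (1 : PowerSeries (PowerSeries R)) = 1 := by
  simpa using curveSubst_C_C a₁ a₂ (1 : R)

/-! ### §2. Multiplicativity for curves through the origin -/

variable {a₁ a₂}

/-- Triangular re-indexing: a double sum over the square `i, k ≤ n` whose terms vanish for `i + k > n` is the
sum over the antidiagonals `i + k = u`, `u ≤ n`. [folklore] -/
private theorem csm_sum_range_range_eq_sum_antidiagonal {M : Type*} [AddCommMonoid M] (n : ℕ) (ψ : ℕ → ℕ → M)
    (h : ∀ i k, n < i + k → ψ i k = 0) :
    ∑ i ∈ range (n + 1), ∑ k ∈ range (n + 1), ψ i k = ∑ u ∈ range (n + 1), ∑ x ∈ antidiagonal u, ψ x.1 x.2 := by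
  rw [← sum_product', sum_sigma']
  rw [← sum_filter_of_ne (p := fun x : ℕ × ℕ ↦ x.1 + x.2 ≤ n) (fun x _ hne ↦ by
    by_contra hx'
    exact hne (h x.1 x.2 (not_le.1 hx')))]
  refine sum_nbij' (fun x ↦ ⟨x.1 + x.2, x⟩) (fun y ↦ y.2) ?_ ?_ ?_ ?_ ?_
  · intro x hx
    simp only [mem_filter, mem_product, mem_range] at hx
    simp only [mem_sigma, mem_range, HasAntidiagonal.mem_antidiagonal, and_true]
    exact Nat.lt_succ_of_le hx.2
  · intro y hy
    simp only [mem_sigma, mem_range, HasAntidiagonal.mem_antidiagonal] at hy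
    simp only [mem_filter, mem_product, mem_range]
    omega
  · intro x _; rfl
  · intro y hy
    simp only [mem_sigma, mem_range, HasAntidiagonal.mem_antidiagonal] at hy
    ext <;> simp [hy.2]
  · intro x _; rfl

/-- The coefficient sum of the restriction may be taken over any larger square: for `m ≤ n`,
`[T^m](G(a₁,a₂)) = Σ_{i,j ≤ n} G_{ij}[T^m](a₁^ia₂^j)` (the extra terms vanish for curves through the origin).
[cite: deShalit1987, II.4.17 (51)–(54) (p. 77–78)] -/
theorem coeff_curveSubst_eq_sum_range (ha₁ : PowerSeries.constantCoeff a₁ = 0)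
    (ha₂ : PowerSeries.constantCoeff a₂ = 0) (G : PowerSeries (PowerSeries R)) {m n : ℕ} (hmn : m ≤ n) :
    PowerSeries.coeff m (curveSubst a₁ a₂ G) = ∑ i ∈ range (n + 1), ∑ j ∈ range (n + 1),
      PowerSeries.coeff j (PowerSeries.coeff i G) * PowerSeries.coeff m (a₁ ^ i * a₂ ^ j) := by
  rw [coeff_curveSubst]
  have hsub : range (m + 1) ⊆ range (n + 1) := range_subset_range.2 (by omega)
  rw [sum_subset hsub]
  · refine sum_congr rfl fun i _ ↦ ?_
    refine sum_subset hsub fun j hj hj' ↦ ?_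
    rw [mem_range] at hj hj'
    rw [coeff_pow_mul_pow_eq_zero_of_lt ha₁ ha₂ (by omega), mul_zero]
  · intro i hi hi'
    rw [mem_range] at hi hi'
    exact sum_eq_zero fun j _ ↦ by rw [coeff_pow_mul_pow_eq_zero_of_lt ha₁ ha₂ (by omega), mul_zero]

/-- **The restriction to a curve through the origin is multiplicative**:
`(G·H)(a₁(T), a₂(T)) = G(a₁(T), a₂(T)) · H(a₁(T), a₂(T))` for `a₁(0) = a₂(0) = 0`.
[cite: deShalit1987, II.4.17 (51)–(54) (p. 77–78)] -/
theorem curveSubst_mul (ha₁ : PowerSeries.constantCoeff a₁ = 0) (ha₂ : PowerSeries.constantCoeff a₂ = 0)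
    (G H : PowerSeries (PowerSeries R)) :
    curveSubst a₁ a₂ (G * H) = curveSubst a₁ a₂ G * curveSubst a₁ a₂ H := by
  ext n
  -- shorthand for the coefficients
  set g : ℕ → ℕ → R := fun i j ↦ PowerSeries.coeff j (PowerSeries.coeff i G) with hg
  set h : ℕ → ℕ → R := fun i j ↦ PowerSeries.coeff j (PowerSeries.coeff i H) with hh
  set c : ℕ → ℕ → ℕ → R := fun m i j ↦ PowerSeries.coeff m (a₁ ^ i * a₂ ^ j) with hc
  have hc0 : ∀ m i j, m < i + j → c m i j = 0 := fun m i j hm ↦ coeff_pow_mul_pow_eq_zero_of_lt ha₁ ha₂ hm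
  -- right-hand side: expand the product and bring both factors to the square `≤ n`
  have hR : PowerSeries.coeff n (curveSubst a₁ a₂ G * curveSubst a₁ a₂ H) =
      ∑ i ∈ range (n + 1), ∑ j ∈ range (n + 1), ∑ k ∈ range (n + 1), ∑ l ∈ range (n + 1),
        g i j * h k l * c n (i + k) (j + l) := by
    rw [PowerSeries.coeff_mul]
    have hstep : ∀ mm ∈ antidiagonal n,
        PowerSeries.coeff mm.1 (curveSubst a₁ a₂ G) * PowerSeries.coeff mm.2 (curveSubst a₁ a₂ H) =
        ∑ i ∈ range (n + 1), ∑ j ∈ range (n + 1), ∑ k ∈ range (n + 1), ∑ l ∈ range (n + 1),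
          g i j * h k l * (c mm.1 i j * c mm.2 k l) := by
      intro mm hmm
      have hmn : mm.1 + mm.2 = n := HasAntidiagonal.mem_antidiagonal.1 hmm
      rw [coeff_curveSubst_eq_sum_range ha₁ ha₂ G (show mm.1 ≤ n by omega),
        coeff_curveSubst_eq_sum_range ha₁ ha₂ H (show mm.2 ≤ n by omega), sum_mul_sum]
      refine sum_congr rfl fun i _ ↦ ?_
      simp_rw [sum_mul_sum]
      rw [sum_comm]
      refine sum_congr rfl fun j _ ↦ sum_congr rfl fun k _ ↦ sum_congr rfl fun l _ ↦ ?_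
      simp only [hg, hh, hc]
      ring
    rw [sum_congr rfl hstep, sum_comm]
    refine sum_congr rfl fun i _ ↦ ?_
    rw [sum_comm]
    refine sum_congr rfl fun j _ ↦ ?_
    rw [sum_comm]
    refine sum_congr rfl fun k _ ↦ ?_
    rw [sum_comm]
    refine sum_congr rfl fun l _ ↦ ?_
    rw [← mul_sum]
    congr 1
    simp only [hc]
    rw [pow_add, pow_add, show a₁ ^ i * a₁ ^ k * (a₂ ^ j * a₂ ^ l) = (a₁ ^ i * a₂ ^ j) * (a₁ ^ k * a₂ ^ l) by ring,
      PowerSeries.coeff_mul]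
  -- left-hand side: the coefficients of `G * H` are double convolutions
  have hL : PowerSeries.coeff n (curveSubst a₁ a₂ (G * H)) =
      ∑ u ∈ range (n + 1), ∑ v ∈ range (n + 1), ∑ ik ∈ antidiagonal u, ∑ jl ∈ antidiagonal v,
        g ik.1 jl.1 * h ik.2 jl.2 * c n u v := by
    rw [coeff_curveSubst]
    refine sum_congr rfl fun u _ ↦ ?_
    refine sum_congr rfl fun v _ ↦ ?_
    simp only [hc]
    rw [PowerSeries.coeff_mul, map_sum, sum_mul]
    refine sum_congr rfl fun ik _ ↦ ?_
    rw [PowerSeries.coeff_mul, sum_mul]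
  rw [hL, hR]
  -- regroup the square sums along antidiagonals, twice
  symm
  calc ∑ i ∈ range (n + 1), ∑ j ∈ range (n + 1), ∑ k ∈ range (n + 1), ∑ l ∈ range (n + 1),
          g i j * h k l * c n (i + k) (j + l)
      = ∑ i ∈ range (n + 1), ∑ k ∈ range (n + 1), ∑ j ∈ range (n + 1), ∑ l ∈ range (n + 1),
          g i j * h k l * c n (i + k) (j + l) := by
        refine sum_congr rfl fun i _ ↦ ?_
        rw [sum_comm]
    _ = ∑ u ∈ range (n + 1), ∑ ik ∈ antidiagonal u, ∑ j ∈ range (n + 1), ∑ l ∈ range (n + 1),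
          g ik.1 j * h ik.2 l * c n (ik.1 + ik.2) (j + l) := by
        refine csm_sum_range_range_eq_sum_antidiagonal n _ fun i k hik ↦ ?_
        exact sum_eq_zero fun j _ ↦ sum_eq_zero fun l _ ↦ by rw [hc0 n _ _ (by omega), mul_zero]
    _ = ∑ u ∈ range (n + 1), ∑ ik ∈ antidiagonal u, ∑ v ∈ range (n + 1), ∑ jl ∈ antidiagonal v,
          g ik.1 jl.1 * h ik.2 jl.2 * c n (ik.1 + ik.2) (jl.1 + jl.2) := by
        refine sum_congr rfl fun u _ ↦ sum_congr rfl fun ik _ ↦ ?_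
        refine csm_sum_range_range_eq_sum_antidiagonal n _ fun j l hjl ↦ ?_
        rw [hc0 n _ _ (by omega), mul_zero]
    _ = ∑ u ∈ range (n + 1), ∑ v ∈ range (n + 1), ∑ ik ∈ antidiagonal u, ∑ jl ∈ antidiagonal v,
          g ik.1 jl.1 * h ik.2 jl.2 * c n u v := by
        refine sum_congr rfl fun u _ ↦ ?_
        rw [sum_comm]
        refine sum_congr rfl fun v _ ↦ sum_congr rfl fun ik hik ↦ sum_congr rfl fun jl hjl ↦ ?_
        rw [HasAntidiagonal.mem_antidiagonal.1 hik, HasAntidiagonal.mem_antidiagonal.1 hjl]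

/-- Powers: `(G^k)(a₁, a₂) = (G(a₁, a₂))^k`. [cite: deShalit1987, II.4.17 (51)–(54) (p. 77–78)] -/
theorem curveSubst_pow (ha₁ : PowerSeries.constantCoeff a₁ = 0) (ha₂ : PowerSeries.constantCoeff a₂ = 0)
    (G : PowerSeries (PowerSeries R)) (k : ℕ) :
    curveSubst a₁ a₂ (G ^ k) = curveSubst a₁ a₂ G ^ k := by
  induction k with
  | zero => rw [pow_zero, pow_zero, curveSubst_one]
  | succ k ih => rw [pow_succ, curveSubst_mul ha₁ ha₂, ih, pow_succ]

end Formal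

/-! ### §3. The monomial lines `G((1+T)^{c₁} − 1, (1+T)^{c₂} − 1)` -/

section Monomial

variable {p : ℕ} [Fact p.Prime] (c₁ c₂ : ℤ_[p])

/-- Additivity along a monomial line. [cite: deShalit1987, II.4.17 (51)–(54) (p. 77–78)] -/
theorem monomialLine_add (G H : PowerSeries (PowerSeries (PadicComplexInt p))) :
    monomialLine c₁ c₂ (G + H) = monomialLine c₁ c₂ G + monomialLine c₁ c₂ H :=
  curveSubst_add _ _ G H

/-- The monomial line of a difference. [cite: deShalit1987, II.4.17 (51)–(54) (p. 77–78)] -/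
theorem monomialLine_sub (G H : PowerSeries (PowerSeries (PadicComplexInt p))) :
    monomialLine c₁ c₂ (G - H) = monomialLine c₁ c₂ G - monomialLine c₁ c₂ H :=
  curveSubst_sub _ _ G H

/-- **Multiplicativity along a monomial line**: `(G·H)|_ℓ = G|_ℓ · H|_ℓ`.
[cite: deShalit1987, II.4.17 (51)–(54) (p. 77–78)] -/
theorem monomialLine_mul (G H : PowerSeries (PowerSeries (PadicComplexInt p))) :
    monomialLine c₁ c₂ (G * H) = monomialLine c₁ c₂ G * monomialLine c₁ c₂ H :=
  curveSubst_mul (constantCoeff_binomPow_sub_one c₁) (constantCoeff_binomPow_sub_one c₂) G H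

/-- Powers along a monomial line. [cite: deShalit1987, II.4.17 (51)–(54) (p. 77–78)] -/
theorem monomialLine_pow (G : PowerSeries (PowerSeries (PadicComplexInt p))) (k : ℕ) :
    monomialLine c₁ c₂ (G ^ k) = monomialLine c₁ c₂ G ^ k :=
  curveSubst_pow (constantCoeff_binomPow_sub_one c₁) (constantCoeff_binomPow_sub_one c₂) G k

/-- Constants along a monomial line. [cite: deShalit1987, II.4.17 (51)–(54) (p. 77–78)] -/
theorem monomialLine_C_C (c : PadicComplexInt p) :
    monomialLine c₁ c₂ (PowerSeries.C (PowerSeries.C c)) = PowerSeries.C c :=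
  curveSubst_C_C _ _ c

/-- `1` along a monomial line. [cite: deShalit1987, II.4.17 (51)–(54) (p. 77–78)] -/
theorem monomialLine_one : monomialLine c₁ c₂ (1 : PowerSeries (PowerSeries (PadicComplexInt p))) = 1 :=
  curveSubst_one _ _

/-- Constant multiples along a monomial line. [cite: deShalit1987, II.4.17 (51)–(54) (p. 77–78)] -/
theorem monomialLine_C_C_mul (c : PadicComplexInt p) (G : PowerSeries (PowerSeries (PadicComplexInt p))) :
    monomialLine c₁ c₂ (PowerSeries.C (PowerSeries.C c) * G) = PowerSeries.C c * monomialLine c₁ c₂ G :=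
  curveSubst_C_C_mul _ _ c G

end Monomial

end IntSeries

end Literature.NumberTheory.EllipticCurves

end
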